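import Mathlib
import HarnessLib
import Summits.HubbardSuperconductivity.HubbardSuperconductivity.Theorems.KLProgrammeH10TwoPointLimitPerturbedCountPairsThin
import Summits.HubbardSuperconductivity.HubbardSuperconductivity.Theorems.KLProgrammeH10TwoPointLimitPerturbedCountThinSmallness

/-!
# Route `KLProgramme` — K3 engine child `KLRegimeEngineV17F2` (stmt-HubbardSuperconductivity-20437), stub (b) import ι₂:
# the THIN anchored pair count on the perturbed curve, UNIFORM over the perturbation class (`∃ κ, K_p`)

Cell gate-hubbard-kl, plan g17 (R41)(i) «E1-P2-THIN-COUNT» (seat p4; assembly, part 4 = the thin twin of `countPairs_perturbed`).  For every level range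
`[a, b] ⊂ (−4, 0)`, near-solution radius `C_r` and margin `m` there are a perturbation size `κ > 0`, a level margin `m₀` (`κ ≤ m₀ ≤ m`), a grid
threshold `w₁ > 0` and a constant `K_p` such that for every `C²` even `δ` with `|δ|, ‖Dδ‖, ‖D²δ‖ ≤ κ`, every `μ` with `[μ − κ − m₀, μ + κ + m₀] ⊂ [a, b]`,
every root selection `u`, every anchor angle `θ₁` and every grid `Nw = 2π` with `w ≤ w₁`, the number of grid pairs `(a, c)` with a near-solution at
radius `C_r w²` is `≤ K_p / w` (the small constants of `exists_thin_small_constants` fed into `count_pairs_thin_perturbed_exists`).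

* **`countPairs_thin_perturbed`**.

Everything is PROVED; no definitions.  References: [cite: BenfattoGiulianiMastropietro2006] Lemma 3.1 / (2.80) / App. A2–A3; [cite: Mastropietro2008] (14.67)
p. 223, p. 229.
-/

noncomputable section

namespace Summit.HubbardSuperconductivity.HubbardSuperconductivity.Theorems.PerturbedFermiCurve

set_option linter.dupNamespace false -- summit = problem name (single-conjunct summit), D-0017

open Classical
open Real Set
open Literature.MathematicalPhysics.QuantumLattice Literature.MathematicalPhysics.QuantumLattice.BandSectorCounting

/-- **The thin anchored pair count on the perturbed Fermi curve, uniformly over the perturbation class.**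
[cite: BenfattoGiulianiMastropietro2006, Lemma 3.1 / (2.80) / App. A2–A3] -/
theorem countPairs_thin_perturbed :
    ∀ a b : ℝ, -4 < a → a ≤ b → b < 0 → ∀ Cr m : ℝ, 0 < Cr → 0 < m →
      ∃ κ : ℝ, 0 < κ ∧ ∃ m₀ : ℝ, 0 < m₀ ∧ m₀ ≤ m ∧ κ ≤ m₀ ∧ ∃ w₁ : ℝ, 0 < w₁ ∧ ∃ Kp : ℝ, 0 < Kp ∧
        ∀ δ : (Fin 2 → ℝ) → ℝ, ContDiff ℝ 2 δ → (∀ k, δ (-k) = δ k) →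
          (∀ k : Fin 2 → ℝ, |δ k| ≤ κ) → (∀ k : Fin 2 → ℝ, ‖fderiv ℝ δ k‖ ≤ κ) → (∀ k : Fin 2 → ℝ, ‖fderiv ℝ (fderiv ℝ δ) k‖ ≤ κ) →
        ∀ μ : ℝ, a ≤ μ - κ - m₀ → μ + κ + m₀ ≤ b →
        ∀ u : ℝ → ℝ, (∀ θ, IsBandFermiRadius (μ - δ (u θ • dir θ)) θ (u θ)) →
        ∀ (θ₁ w : ℝ) (N Nh : ℕ), 0 < w → w ≤ w₁ → (N : ℝ) * w = 2 * π → (Nh : ℝ) * w = π → N = 2 * Nh →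
          ((((Finset.range N ×ˢ Finset.range N).filter fun p : ℕ × ℕ =>
            ∃ θ₁' x' y' : ℝ, |θ₁ - θ₁'| ≤ w ∧ |w / 2 + p.1 * w - x'| ≤ w ∧ |w / 2 + p.2 * w - y'| ≤ w ∧
              |hfunE δ u μ (XE u θ₁', YE u θ₁') x' y'| ≤ Cr * w ^ 2).card : ℝ)) ≤ Kp / w := by
  intro a b ha hab hb Cr m hCr hm
  obtain ⟨B, -⟩ : ∃ B : BandBounds a b, B = bandBounds ha hab hb := ⟨_, rfl⟩
  obtain ⟨κ, τ, lam, f, e, s, hκ0, hκD, hκs, hs0, hsm, hτ0, hτπ, hlam0, hf0, he0, hfs, hes, hes2,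
    c1, c2, c3, c4, c5, c6, c7, c8, c9, c10, c11, c12, c13, c14, c16, c17, c18, c19, c20⟩ := exists_thin_small_constants B hm
  obtain ⟨Kp, hKp, hcount⟩ := count_pairs_thin_perturbed_exists B (κ₀ := κ) (κ₁ := κ) (κ₂ := κ) (Cr := Cr) (τ := τ) (lam := lam) (η₀F := f)
    (η₀K := 2 * e) (η₀'' := e) (η₁'' := e) (η₀S := s) (η₁S := s) (R := 2 * e / B.hmin) (m₀ := s)
    hκ0.le hκD hκ0.le hCr hτ0 hτπ hlam0 hf0 hfs le_rfl hes hes2 c1 c2 c3 c4 hs0 hs0 c5 he0 (by have := B.hmin_pos; positivity)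
    c6 c7 c8 c9 c10 c11 c12 c13 c14 le_rfl c16 c17 c18 c19 c20
  -- the grid threshold
  set Kfat := Cr + 3 * ((4 + κ) * pcSE B κ) with hKfat
  set K₁ := 5 * ((4 + κ) * pcSE B κ ^ 2) + 3 * ((4 + κ) * pcAE B κ κ) with hK₁
  set K₂ := 8 * ((4 + κ) * pcSE B κ ^ 2) + 2 * ((4 + κ) * pcAE B κ κ) with hK₂
  set K₃ := 3 * ((4 + κ) * pcSE B κ ^ 2) + 2 * ((4 + κ) * pcAE B κ κ) with hK₃
  set Ccoop := (Cr + 2 * Cr / 1 + 2 * K₁ + K₂) + K₁ * τ with hCcoop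
  set Cfold := (Cr + 8 * K₃) + 2 * K₃ * π + K₃ * τ with hCfold
  obtain ⟨-, hSE, -, -, hAE, -⟩ := pc_pos B hκ0.le hκD hκ0.le
  have hKfat0 : 0 < Kfat := by rw [hKfat]; positivity
  have hCcoop0 : 0 < Ccoop := by rw [hCcoop, hK₁, hK₂]; positivity
  have hCfold0 : 0 < Cfold := by rw [hCfold, hK₃]; positivity
  set w₁ := min 1 (min (f / 2 / Kfat) (min (f / 2 / Ccoop) (f / 2 / Cfold))) with hw₁
  have hw₁0 : 0 < w₁ := lt_min one_pos (lt_min (by positivity) (lt_min (by positivity) (by positivity)))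
  refine ⟨κ, hκ0, s, hs0, hsm, hκs, w₁, hw₁0, Kp, hKp, ?_⟩
  intro δ hδs heven hδ hκ hκ₂ μ hlo hhi u hu θ₁ w N Nh hw hww hN hNh hNN
  have hw1 : w ≤ 1 := hww.trans (min_le_left _ _)
  have hwf : w ≤ f / 2 / Kfat := hww.trans ((min_le_right _ _).trans (min_le_left _ _))
  have hwc : w ≤ f / 2 / Ccoop := hww.trans ((min_le_right _ _).trans ((min_le_right _ _).trans (min_le_left _ _)))
  have hwd : w ≤ f / 2 / Cfold := hww.trans ((min_le_right _ _).trans ((min_le_right _ _).trans (min_le_right _ _)))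
  have e1 : Kfat * w ≤ f / 2 := by rw [le_div_iff₀ hKfat0] at hwf; linarith only [hwf]
  have e2 : Ccoop * w ≤ f / 2 := by rw [le_div_iff₀ hCcoop0] at hwc; linarith only [hwc]
  have e3 : Cfold * w ≤ f / 2 := by rw [le_div_iff₀ hCfold0] at hwd; linarith only [hwd]
  exact hcount δ hδs heven hδ hκ hκ₂ μ hlo hhi u hu θ₁ w N Nh hw hw1 hN hNh hNN e1 e2 e3

end Summit.HubbardSuperconductivity.HubbardSuperconductivity.Theorems.PerturbedFermiCurve

end
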